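import Summits.QuantumAdvantage.QuantumAdvantage.Theses.LinnikCubicClassGroups
import Literature.Uncategorized.DegreeOnePrimesEscapeWithoutProper

/-!
# `DegreeOnePrimesEscape`: the properness hypothesis `M ≠ ⊤` is load-bearing

Negative knowledge for crux `stmt-QuantumAdvantage-11543` (route LinnikCubicClassGroups): the crux
with `M ≠ ⊤` dropped is FALSE (witness `n = 1`, `K = ℚ`, `x = 2`). Refuter work file:
`Summits/QuantumAdvantage/QuantumAdvantage/Cruxes/DegreeOnePrimesEscape/Disproof.lean`.
-/


open scoped NumberField nonZeroDivisors

namespace Summit.QuantumAdvantage.QuantumAdvantage.Theorems.DegreeOnePrimesEscape.Negative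

/-- **`M ≠ ⊤` is load-bearing in `DegreeOnePrimesEscape`**: with `M = ⊤` allowed the statement
fails at `n = 1`, `K = ℚ`, `x = 2`, for every exponent `C` (`|d_ℚ|^C = 1 ≤ 2`, `π(2) = 1`, and
nothing escapes `⊤`). [folklore] -/
theorem degreeOnePrimesEscape_false_without_proper : ¬ Literature.Uncategorized.DegreeOnePrimesEscapeWithoutProper := by
  intro h
  obtain ⟨C, hC⟩ := h 1
  have hq : ∀ F : IntermediateField ℚ ℚ, Module.finrank ℚ F ≠ 2 := by
    intro F hF
    have h := F.toSubalgebra.toSubmodule.finrank_le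
    simp only [Module.finrank_self] at h
    have h' : Module.finrank ℚ F ≤ 1 := h
    omega
  have key := hC ℚ (Module.finrank_self ℚ) hq 2 (by rw [NumberField.discr_rat]; simp) ⊤
  have hempty : {P : Ideal (𝓞 ℚ) | P.IsPrime ∧ (Ideal.absNorm P).Prime ∧ Ideal.absNorm P ≤ 2 ∧
      ∃ hP : P ∈ nonZeroDivisors (Ideal (𝓞 ℚ)), ClassGroup.mk0 ⟨P, hP⟩ ∉ (⊤ : Subgroup _)} = ∅ := by
    ext P
    simp
  have h2 : Nat.primeCounting 2 = 1 := by decide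
  rw [hempty, Set.ncard_empty, h2] at key
  omega

end Summit.QuantumAdvantage.QuantumAdvantage.Theorems.DegreeOnePrimesEscape.Negative
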